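import Summits.QuantumFields.YangMills.Theorems.BalabanUVNodesN15KingModelCovariantDecay
import Summits.QuantumFields.YangMills.Theorems.BalabanUVNodesN15KingModelCovariantSpectralBounds
import HarnessLib

/-!
# BalabanUVNodes ∕ N15 — THE KING-MODEL RUNG (PART Ͱ-h): PAIRINGS AND THE UPPER EDGE — `|⟨f, G_Ug⟩| ≤ ⟨|f|, G|g|⟩` (the covariant Gaussian's covariance form is dominated by
# King's `A = 0` form on the fibre norms), and `Re⟨v, (−cΔ_U+m²)v⟩ ≤ (m²+4(d+1)c)‖v‖²`: the covariant spectrum lies in King's symbol range `[m², m²+4(d+1)c]` at every unitary `U`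
# (Track A, DAG node N15 = NE2; FAN-OUT v1.1 §N15 s3 «KING-MODEL RUNG … what the curved case adds»; count-neutral)

HONEST FRAMING.  Count-neutral (cell `pub-ymgap`, seat `pub-ymgap-dag-n15-e` g42; `--supports stmt-QuantumFields-27247 --as helper` = K3ᴬ, KEY MAP v3).  One finite torus at fixed
spacing; the fine covariance layer only (NOT Bałaban's `G_k(U)`, NOT (3.42)); NOT a node discharge (N15 of record untouched); nothing continuum ∕ ℝ⁴ ∕ OS ∕ Clay.

THE RESULTS (every period vector, `c ≥ 0`, `m² > 0`, fibre `𝕜ⁿ`, unitary `U`; `G = (lapF K c m²)⁻¹`, `G_U = (covLapF K c m² U)⁻¹`, `fib` the fibres of PART Ͱ-b):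
* §1 `star_dotProduct_eq_sum_inner_fib` (`⟨f, v⟩ = Σ_x⟪f_x, v_x⟫`), ★★★ **`norm_star_dotProduct_inv_mulVec_le`** — `|⟨f, G_Ug⟩| ≤ Σ_xΣ_y‖f_x‖·G(x,y)·‖g_y‖` for all sources `f, g`
  (Cauchy–Schwarz fibrewise + Ͱ-e's kernel domination `‖(G_Ug)_x‖ ≤ Σ_yG(x,y)‖g_y‖`): the covariance form of the minimally coupled Gaussian at ANY unitary link field is dominated by
  King's `A = 0` form on the fibre norms ([BrydgesFrohlichSeiler1979]'s diamagnetic inequality at the level of the propagator pairing, as invoked in [Balaban1982Higgs2] (3.38));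
  ★★ **`re_star_dotProduct_inv_mulVec_self_le`** (`0 ≤ Re⟨f, G_Uf⟩ ≤ ⟨|f|, G|f|⟩`), ★★ **`norm_star_dotProduct_inv_mulVec_le_exp`** (with Ε-d's decay: sources with disjoint far-apart
  supports are exponentially weakly correlated, uniformly in `U`);
* §2 ★★ **`re_quadForm_covLapF_le`** — `Re⟨v, M_Uv⟩ ≤ (m²+4(d+1)c)·‖v‖²` (Ͱ-d's Dirichlet form with `‖v_x − U v_{x+e}‖² ≤ 2‖v_x‖² + 2‖v_{x+e}‖²`), ★★★ **`eigenvalues_covLapF_le`** — every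
  eigenvalue of `−cΔ_U+m²` is `≤ m²+4(d+1)c`: with Ͱ-f's floor `m²` the covariant spectrum lies in `[m², m²+4(d+1)c]` = the range of King's symbol `lapSym` (Ε-e `lapSym_le`∕`lapSym_ge`),
  at EVERY unitary `U` — the link field moves eigenvalues only inside King's band.

PRIOR TREE ART (by name): Ͱ-a∕b∕d∕e (`covLapF`, `fib`, `isHermitian_covLapF`, `posDef_covLapF_inv`, `re_quadForm_covLapF`, `sum_norm_fib_add_unitVec`, `norm_fib_inv_mulVec_le_sum`,
`norm_fib_inv_mulVec_le_exp_sum`, `lapF_inv_entry_nonneg`, `norm_toEuclideanLin_of_mem_unitaryGroup`), Ͱ-f (`sum_norm_fib_sq`), Mathlib (`PiLp.inner_apply`, `norm_inner_le_norm`, `IsHermitian.eigenvalues_eq`).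
Dedup (rg at filing): basename 0 files; needles `star_dotProduct_eq_sum_inner_fib|norm_star_dotProduct_inv_mulVec_le|re_quadForm_covLapF_le|eigenvalues_covLapF_le` 0 tree files.
Locators: [Balaban1982Higgs2] (3.38) p.591; [King1986] (4.4) p.670, (4.35) p.674; [Balaban1985BackgroundPropagators] (3.23) p.394, (3.42) p.397; [DodziukMathai2006] §1 Thm 1.5, Cor 1.3.  0 `sorry`, 0 `def`.
-/

noncomputable section

open scoped BigOperators ComplexConjugate ComplexOrder Kronecker InnerProductSpace
open Finset Matrix WithLp

namespace Summit.QuantumFields.YangMills.BalabanUVNodes.N15KingModelRung.Covariant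

open Literature.MathematicalPhysics.QuantumFieldTheory.LatticeDiamagneticInequality (Hopping blk)
open Literature.MathematicalPhysics.QuantumFieldTheory.Balaban1983to89.B5Prop11Plancherel (Tor unitVec)
open Literature.MathematicalPhysics.QuantumFieldTheory.Balaban1983to89.B4TorusKernel (periodConst)
open Literature.MathematicalPhysics.QuantumFieldTheory.King1986.Torus (lapF tdistT)
open Summit.QuantumFields.YangMills.BalabanUVNodes.N15KingModelRung.TorusSpectral (kappaFree periodConst_kappaFree_nonneg)

variable {d : ℕ} (K : Fin (d + 1) → ℕ) [hK : ∀ μ, NeZero (K μ)]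
variable {𝕜 : Type*} [RCLike 𝕜] {n : Type*} [Fintype n] [DecidableEq n] {c m2 : ℝ}

/-! ## §1 Pairings: `|⟨f, G_Ug⟩| ≤ ⟨|f|, G|g|⟩` -/

omit [DecidableEq n] in
/-- The `ℓ²` pairing is the sum of the fibre inner products: `star f ⬝ᵥ v = Σ_x⟪f_x, v_x⟫`. [folklore] -/
theorem star_dotProduct_eq_sum_inner_fib (f v : Tor K × n → 𝕜) : star f ⬝ᵥ v = ∑ x, ⟪fib K f x, fib K v x⟫_𝕜 := by
  simp only [dotProduct, Pi.star_apply, PiLp.inner_apply, fib_apply, RCLike.inner_apply', Fintype.sum_prod_type]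
  rfl

/-- ★★★ **THE PAIRING IS DOMINATED BY KING's ON THE FIBRE NORMS**: for every unitary `U`, all sources `f, g`,
`|⟨f, G_Ug⟩| ≤ Σ_xΣ_y‖f_x‖·G(x,y)·‖g_y‖` (`G = (c(−Δ)+m²)⁻¹`). [cite: Balaban1982Higgs2, (3.38) p.591; DodziukMathai2006, Thm 1.5 §1; King1986, (4.4) p.670] -/
theorem norm_star_dotProduct_inv_mulVec_le (hc : 0 ≤ c) (hm : 0 < m2) {U : Tor K × Fin (d + 1) → Matrix n n 𝕜} (hU : ∀ b, U b ∈ Matrix.unitaryGroup n 𝕜)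
    (f g : Tor K × n → 𝕜) :
    ‖star f ⬝ᵥ ((covLapF K c m2 U)⁻¹ *ᵥ g)‖ ≤ ∑ x, ∑ y, ‖fib K f x‖ * (lapF K c m2)⁻¹ x y * ‖fib K g y‖ := by
  rw [star_dotProduct_eq_sum_inner_fib]
  refine (norm_sum_le _ _).trans (Finset.sum_le_sum fun x _ => (norm_inner_le_norm _ _).trans ?_)
  rw [Finset.sum_congr rfl fun y _ => mul_assoc _ _ _, ← Finset.mul_sum]
  exact mul_le_mul_of_nonneg_left (norm_fib_inv_mulVec_le_sum K hc hm hU g x) (norm_nonneg _)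

/-- ★★ **THE DIAGONAL PAIRING**: `0 ≤ Re⟨f, G_Uf⟩ ≤ Σ_xΣ_y‖f_x‖·G(x,y)·‖f_y‖` — the exponent of the minimally coupled Gaussian's generating functional is dominated by King's `A = 0`
exponent at the fibre norms. [cite: Balaban1982Higgs2, (3.38) p.591; King1986, (4.4) p.670] -/
theorem re_star_dotProduct_inv_mulVec_self_le (hc : 0 ≤ c) (hm : 0 < m2) {U : Tor K × Fin (d + 1) → Matrix n n 𝕜} (hU : ∀ b, U b ∈ Matrix.unitaryGroup n 𝕜)
    (f : Tor K × n → 𝕜) :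
    0 ≤ RCLike.re (star f ⬝ᵥ ((covLapF K c m2 U)⁻¹ *ᵥ f)) ∧
      RCLike.re (star f ⬝ᵥ ((covLapF K c m2 U)⁻¹ *ᵥ f)) ≤ ∑ x, ∑ y, ‖fib K f x‖ * (lapF K c m2)⁻¹ x y * ‖fib K f y‖ :=
  ⟨(posDef_covLapF_inv K hc hm hU).posSemidef.re_dotProduct_nonneg f,
    (RCLike.re_le_norm _).trans (norm_star_dotProduct_inv_mulVec_le K hc hm hU f f)⟩

/-- ★★ **WITH THE DECAY**: `|⟨f, G_Ug⟩| ≤ (2∕m²)·periodConst κ_F d·Σ_xΣ_y e^{−(κ_F∕(d+1))·tdistT K x y}‖f_x‖‖g_y‖` at every unitary `U` — sources far apart are exponentially weakly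
paired, uniformly in the link field and the volume. [cite: King1986, (4.4) p.670, (4.38) p.674; Balaban1984PropagatorsI, p.38 (1.126)] -/
theorem norm_star_dotProduct_inv_mulVec_le_exp (hc : 0 ≤ c) (hm : 0 < m2) {U : Tor K × Fin (d + 1) → Matrix n n 𝕜} (hU : ∀ b, U b ∈ Matrix.unitaryGroup n 𝕜)
    (f g : Tor K × n → 𝕜) :
    ‖star f ⬝ᵥ ((covLapF K c m2 U)⁻¹ *ᵥ g)‖
      ≤ 2 / m2 * periodConst (kappaFree c m2 d) d * ∑ x, ∑ y, Real.exp (-(kappaFree c m2 d / (d + 1) * tdistT K x y)) * ‖fib K f x‖ * ‖fib K g y‖ := by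
  rw [star_dotProduct_eq_sum_inner_fib, Finset.mul_sum]
  refine (norm_sum_le _ _).trans (Finset.sum_le_sum fun x _ => (norm_inner_le_norm _ _).trans ?_)
  refine (mul_le_mul_of_nonneg_left (norm_fib_inv_mulVec_le_exp_sum K hc hm hU g x) (norm_nonneg _)).trans (le_of_eq ?_)
  rw [Finset.mul_sum, Finset.mul_sum, Finset.mul_sum]
  exact Finset.sum_congr rfl fun y _ => by ring

/-! ## §2 The upper edge: `Re⟨v, M_Uv⟩ ≤ (m²+4(d+1)c)‖v‖²`, eigenvalues `≤ m²+4(d+1)c` -/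

/-- One covariant difference squared is at most twice the sum of the squares (`U` unitary): `‖a − Ub‖² ≤ 2‖a‖² + 2‖b‖²`. [folklore] -/
theorem norm_sub_transport_sq_le {W : Matrix n n 𝕜} (hW : W ∈ Matrix.unitaryGroup n 𝕜) (a b : EuclideanSpace 𝕜 n) :
    ‖a - Matrix.toEuclideanLin W b‖ ^ 2 ≤ 2 * ‖a‖ ^ 2 + 2 * ‖b‖ ^ 2 := by
  have h1 : ‖a - Matrix.toEuclideanLin W b‖ ≤ ‖a‖ + ‖b‖ := (norm_sub_le _ _).trans (by rw [norm_toEuclideanLin_of_mem_unitaryGroup hW])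
  have h0 : 0 ≤ ‖a - Matrix.toEuclideanLin W b‖ := norm_nonneg _
  nlinarith [sq_nonneg (‖a‖ - ‖b‖), norm_nonneg a, norm_nonneg b]

/-- ★★ **THE UPPER FORM BOUND**: `Re⟨v, (−cΔ_U+m²)v⟩ ≤ (m² + 4(d+1)c)·‖v‖²` for every unitary `U`, `c ≥ 0` — the covariant kinetic energy never exceeds King's symbol maximum
`4(d+1)c` times the norm. [cite: King1986, (4.4) p.670, (4.35) p.674; Balaban1985BackgroundPropagators, (3.23) p.394] -/
theorem re_quadForm_covLapF_le (hc : 0 ≤ c) (m2 : ℝ) {U : Tor K × Fin (d + 1) → Matrix n n 𝕜} (hU : ∀ b, U b ∈ Matrix.unitaryGroup n 𝕜) (v : Tor K × n → 𝕜) :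
    RCLike.re (star v ⬝ᵥ (covLapF K c m2 U *ᵥ v)) ≤ (m2 + 4 * ((d : ℝ) + 1) * c) * ‖(toLp 2 v : EuclideanSpace 𝕜 (Tor K × n))‖ ^ 2 := by
  rw [re_quadForm_covLapF K c m2 hU v, ← sum_norm_fib_sq]
  have hkin : ∑ x, ∑ μ, ‖fib K v x - Matrix.toEuclideanLin (U (x, μ)) (fib K v (x + unitVec K μ))‖ ^ 2 ≤ 4 * ((d : ℝ) + 1) * ∑ x, ‖fib K v x‖ ^ 2 := by
    calc ∑ x, ∑ μ, ‖fib K v x - Matrix.toEuclideanLin (U (x, μ)) (fib K v (x + unitVec K μ))‖ ^ 2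
        ≤ ∑ x, ∑ μ : Fin (d + 1), (2 * ‖fib K v x‖ ^ 2 + 2 * ‖fib K v (x + unitVec K μ)‖ ^ 2) :=
          Finset.sum_le_sum fun x _ => Finset.sum_le_sum fun μ _ => norm_sub_transport_sq_le (hU _) _ _
      _ = 4 * ((d : ℝ) + 1) * ∑ x, ‖fib K v x‖ ^ 2 := by
          simp only [Finset.sum_add_distrib, Finset.sum_const, Finset.card_univ, Fintype.card_fin, nsmul_eq_mul]
          rw [Finset.sum_comm (f := fun x μ => 2 * ‖fib K v (x + unitVec K μ)‖ ^ 2)]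
          simp only [← Finset.mul_sum, sum_norm_fib_add_unitVec, Finset.sum_const, Finset.card_univ, Fintype.card_fin, nsmul_eq_mul]
          push_cast; ring
  nlinarith [mul_le_mul_of_nonneg_left hkin hc, Finset.sum_nonneg (fun x (_ : x ∈ Finset.univ) => sq_nonneg ‖fib K v x‖)]

/-- ★★★ **THE UPPER EDGE OF THE COVARIANT SPECTRUM**: every eigenvalue of `−cΔ_U+m²` (any unitary `U`, `c ≥ 0`) is `≤ m² + 4(d+1)c` — together with Ͱ-f's floor `m²` the whole
covariant spectrum lies in King's symbol band `[m², m²+4(d+1)c]` (Ε-e `lapSym_ge`∕`lapSym_le`), at EVERY link field. [cite: King1986, (4.4) p.670, (4.35) p.674; DodziukMathai2006, Cor 1.3 §1] -/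
theorem eigenvalues_covLapF_le (hc : 0 ≤ c) (m2 : ℝ) {U : Tor K × Fin (d + 1) → Matrix n n 𝕜} (hU : ∀ b, U b ∈ Matrix.unitaryGroup n 𝕜) (i : Tor K × n) :
    (isHermitian_covLapF K c m2 U).eigenvalues i ≤ m2 + 4 * ((d : ℝ) + 1) * c := by
  set hA := isHermitian_covLapF K c m2 U
  rw [hA.eigenvalues_eq i]
  have h := re_quadForm_covLapF_le K hc m2 hU (⇑(hA.eigenvectorBasis i))
  have hnorm : ‖(toLp 2 (⇑(hA.eigenvectorBasis i)) : EuclideanSpace 𝕜 (Tor K × n))‖ = 1 := hA.eigenvectorBasis.orthonormal.1 i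
  rwa [hnorm, one_pow, mul_one] at h

end Summit.QuantumFields.YangMills.BalabanUVNodes.N15KingModelRung.Covariant

end
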